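import Summits.CriticalPhenomena.PercolationContinuityZ3.Theorems.Transplant.PlanarSkeletonFrmQuasiDefs
import Summits.CriticalPhenomena.PercolationContinuityZ3.Theorems.Transplant.SkelFrmQuasiBParamsFaceFloorsXGenA
import Summits.CriticalPhenomena.PercolationContinuityZ3.Theorems.Transplant.SkelFrmBParamsFaceFloorsXGenA
import Summits.CriticalPhenomena.PercolationContinuityZ3.Theorems.Transplant.SkelFrmQuasiBParamsFaceFloorsYxA
import Summits.CriticalPhenomena.PercolationContinuityZ3.Theorems.Transplant.SkelFrmBParamsFaceFloorsYxA
import HarnessLib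
import Summits.CriticalPhenomena.PercolationContinuityZ3.Theorems.Transplant.SkelFrmBParamsFaceFloorsYxH
/-!
# GEN-Q PORT (WAVE-Q table v0.8 section 2, row G219, U-level L22; captain R-6/R-7 2026-08-27: carrier token swap `PlanarSkeletonFrmFrom ↦ PlanarSkeletonFrmQuasi`)
# of the tree module «Transplant/SkelFrmFromBParamsFaceFloorsYxH» (sha256 934b05088f312165…) onto the quasi-step carrier `PlanarSkeletonFrmQuasi` (p507026): «SkelFrmQuasiBParamsFaceFloorsYxH»

HAND HUNK (L-FLOORMAP-1 ①⑥ / L-KitS-1 reader side; G017 «SkelFrmQuasiBChoiceNums», hp-8's KitSN): R'0×6 — the (S0) kit of record at window cost `KS.NQ Φ`.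

ORIGINAL TITLE: N2 (frames-only node, OPEN) — (F) column, (R-49)(c2b) VALUE LAYER part E3: **THE TWO π-BUDGET ROWS OF THE X4-SHAPED y′-FACE ROUTE** (hp-8 g43)

builds on p205010 (kernel theorem, internal audit signed; external expert review pending) — nothing in this file uses p205010; NOTHING is claimed about any open node
((N3-b), the end state).  Lane `prim-bschramm`, seat `prim-bschramm-stmt` (gen 33; GEN-Q column pen; tool = captain gen-1 g4's port_genq.py R-14 --cone + p3-g30's T1 patch).  Helper file (`--supports stmt-CriticalPhenomena-4575 --as helper`).
PORT RULES (U-wave r1–r4 re-used, GEN-Q hunk classes of p3-g29 #6136): declaration order, names and proof texts are those of «SkelFrmFromBParamsFaceFloorsYxH», byte-identical except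
(i) the carrier token `PlanarSkeletonFrmFrom ↦ PlanarSkeletonFrmQuasi` in binders, `namespace`/`end` lines and qualified names (module names `SkelFrmFrom… ↦ SkelFrmQuasi…`
in imports of already-ported rows); (ii) `Φ.step ↦ Φ.qstep` with the called Steps lemma replaced by its `…Q`/`_q` twin and the cost `Φ.M` threaded (none in this file unless
listed below); (iii) `Φ.cyl_connected ↦ Φ.cyl_reach` readers (none unless listed); (iv) graph-ball radii / window floors ×`Φ.M` (none unless listed).  Carrier-free
residents stay imported/exported from the original «SkelFrmBParamsFaceFloorsYxH» exactly as in the FrmFrom port.  Docstrings and citations are the original's.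

-/

noncomputable section

open scoped Classical

namespace Summit.CriticalPhenomena.PercolationContinuityZ3.Theorems.Transplant

namespace PlanarSkeletonFrmQuasi

namespace NegB

open Literature.Probability.Percolation Literature.Probability.LatticeModels SimpleGraph
open Literature.Probability.Percolation.KozmaNitzan.Cells (oth sgOf sgOf_sign)
open SkelConc (Consts)
open Skelφ (shearUnit shearUnit_pos xBoxLoA yBoxLoT yBoxHiT yBoxLoS crossOffX yPrmW)
open Skelφ.StepI (DataN)
open TwoAxis.Para (modulus)
open Neg

namespace KS

/-- (R-49)(c2b) TWIN (prefix count `NxW`) of **the field `hπ2X`** at the (ζ′) tuple (pinned conclusion; premise block trimmed; added served hyps `hSF`, `hyl`, `hr`): the along run's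
sheared prism lies within the window radius. [cite: KozmaNitzan2024, §4 Lemma 12 (pp. 23–25)] -/
theorem hπ2_Yx (κ : Consts) {V : Type} [DecidableEq V] [Countable V] {G : SimpleGraph V} [G.LocallyFinite] (Φ : PlanarSkeletonFrmQuasi G) (t : V) (p : unitInterval) (D : Skelφ.StepI.DataNS V) (c : ℕ) (mk : ℕ) (g : ℕ) (f : ℕ) (P : PCells2T)
    (x : Site 2) (du : MDir) (z : Site 2) (bw : ℕ)
    (yL : Site 2) (hNx : NxW κ Φ t p D g f P yL x du z bw + 1 ≤ 240 * Neg.Kq κ + 10)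
    (hyl : (yL 0).natAbs + (yL 1).natAbs ≤ YbF κ Φ t p D c mk g f) (r : ℕ) (hr : πBudX κ Φ t p D c mk g f ≤ r) :
    ((yL 0).natAbs + (yL 1).natAbs) + ((NxW κ Φ t p D g f P yL x du z bw) + 1) * shearUnit (nL κ Φ t p D g f) (prFA κ Φ t p D g f).h ≤ r := by
  have eh : (prFA κ Φ t p D g f).h = hL κ Φ t p D g f := rfl
  rw [eh]
  have hu : 1 ≤ u₀A κ Φ t p D g f := (units_eqA κ Φ t p D g f).2.2.2.2.1
  have hNr : NxW κ Φ t p D g f P yL x du z bw + 1 ≤ 600 * Neg.Kq κ := by have := Neg.one_le_Kq κ; omega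
  refine le_trans ?_ hr
  unfold πBudX
  have h1 : (NxW κ Φ t p D g f P yL x du z bw + 1) * shearUnit (nL κ Φ t p D g f) (hL κ Φ t p D g f) ≤
      600 * Neg.Kq κ * shearUnit (nL κ Φ t p D g f) (hL κ Φ t p D g f) := Nat.mul_le_mul_right _ hNr
  omega

/-- (R-49)(c2b) TWIN (prefix count `NxW`, any second-run count `N₃`) of **the field `hπ3X`** at the (ζ′) tuple (pinned conclusion; premise block trimmed; added served hyps `hSF`, `hyl`, `hr`): the tangential
y′-run's origin plus every region's drift lies within the window radius. [cite: KozmaNitzan2024, §4 Lemma 12 (pp. 23–25)] -/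
theorem hπ3_Yx (κ : Consts) {V : Type} [DecidableEq V] [Countable V] {G : SimpleGraph V} [G.LocallyFinite] (Φ : PlanarSkeletonFrmQuasi G) (t : V) (p : unitInterval) (D : Skelφ.StepI.DataNS V) (c : ℕ) (mk : ℕ) (g : ℕ) (f : ℕ) (P : PCells2T) (hN : EqNumL κ Φ t p D g f) (hκ : (hL κ Φ t p D g f).natAbs ≤ 10 * nL κ Φ t p D g f)
    (hℓA : 22000 * Neg.Kq κ * (KS0.R'0N κ Φ (KS.NQ Φ) t p D mk + 2) ≤ ℓL κ Φ t p D g f)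
    (x : Site 2) (du : MDir) (z : Site 2) (bw : ℕ)
    (yL : Site 2) {σT : ℤ} (hσT : σT = 1 ∨ σT = -1) {N₃ : ℕ} (hN₃ : N₃ + 1 ≤ 600 * Neg.Kq κ) (hNx : NxW κ Φ t p D g f P yL x du z bw + 1 ≤ 240 * Neg.Kq κ + 10)
    (hyl : (yL 0).natAbs + (yL 1).natAbs ≤ YbF κ Φ t p D c mk g f) (r : ℕ) (hr : πBudX κ Φ t p D c mk g f ≤ r) :
    ∀ k ≤ N₃, (((yL + crossOffX (nL κ Φ t p D g f) (prFA κ Φ t p D g f).h (prFA κ Φ t p D g f).vα (sgOf du) σT (NxW κ Φ t p D g f P yL x du z bw)) 0).natAbs + ((yL + crossOffX (nL κ Φ t p D g f) (prFA κ Φ t p D g f).h (prFA κ Φ t p D g f).vα (sgOf du) σT (NxW κ Φ t p D g f P yL x du z bw)) 1).natAbs) + (((((k + 1 : ℕ) : ℤ) * (prFA κ Φ t p D g f).vα).natAbs + (((shearUnit (nL κ Φ t p D g f) (prFA κ Φ t p D g f).h : ℤ) * |((k + 1 : ℕ) : ℤ) * (yPrmW (nL κ Φ t p D g f) (ℓL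 κ Φ t p D g f) (prFA κ Φ t p D g f).h (prFA κ Φ t p D g f).vα (KS0.R'0N κ Φ (KS.NQ Φ) t p D mk) (qB3XA κ Φ t p D g f (KS0.R'0N κ Φ (KS.NQ Φ) t p D mk)) N₃).sLo| + |(prFA κ Φ t p D g f).h| * |((k + 1 : ℕ) : ℤ) * (prFA κ Φ t p D g f).vα| + shearUnit (nL κ Φ t p D g f) (prFA κ Φ t p D g f).h) / (nL κ Φ t p D g f)).natAbs + 1)) ≤ r := by
  have eh : (prFA κ Φ t p D g f).h = hL κ Φ t p D g f := rfl
  have ev : (prFA κ Φ t p D g f).vα = vL κ Φ t p D g f := rfl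
  simp only [eh, ev]
  intro k hk
  obtain ⟨hn1, -⟩ := one_le_of_eqNumL κ Φ t p D g f hN
  have hn0 : (0 : ℤ) < (nL κ Φ t p D g f : ℤ) := by exact_mod_cast hn1
  have hu0 : 1 ≤ u₀A κ Φ t p D g f := (units_eqA κ Φ t p D g f).2.2.2.2.1
  have hu1 : 1 ≤ u₁A κ Φ t p D g f := (units_eqA κ Φ t p D g f).2.2.2.2.2
  have hσ : sgOf du = 1 ∨ sgOf du = -1 := sgOf_sign du
  have hU := shearUnit_pos hn1 (hL κ Φ t p D g f)
  obtain ⟨-, hU2⟩ := clr_shearUnit_bounds κ Φ t p D g f hκ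
  have hκ' : |hL κ Φ t p D g f| ≤ 10 * (nL κ Φ t p D g f : ℤ) := by rw [← Int.natCast_natAbs]; exact_mod_cast hκ
  have hq1 : 1 ≤ Neg.Kq κ := Neg.one_le_Kq κ
  have hℓ11 : (11 : ℤ) ≤ (ℓL κ Φ t p D g f : ℤ) := by
    have h2 : 1 * (0 + 2) ≤ Neg.Kq κ * (KS0.R'0N κ Φ (KS.NQ Φ) t p D mk + 2) := Nat.mul_le_mul hq1 (by omega)
    have : 11 ≤ ℓL κ Φ t p D g f := by nlinarith only [hℓA, h2]
    exact_mod_cast this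
  have hnℓ : (nL κ Φ t p D g f : ℤ) * 11 ≤ (nL κ Φ t p D g f : ℤ) * ℓL κ Φ t p D g f := mul_le_mul_of_nonneg_left hℓ11 hn0.le
  have sL' : (shearUnit (nL κ Φ t p D g f) (hL κ Φ t p D g f) : ℤ) * sLoY κ Φ t p D g f ≤
      (nL κ Φ t p D g f : ℤ) * ℓL κ Φ t p D g f - (shearUnit (nL κ Φ t p D g f) (hL κ Φ t p D g f) : ℤ) + 1 := by unfold sLoY; exact Int.mul_ediv_self_le hU.ne'
  have hs0 : 0 ≤ sLoY κ Φ t p D g f := by unfold sLoY; exact Int.ediv_nonneg (by linarith only [hU2, hnℓ]) hU.le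
  have hNr : NxW κ Φ t p D g f P yL x du z bw + 1 ≤ 600 * Neg.Kq κ := by have := Neg.one_le_Kq κ; omega
  have hk1 : ((k + 1 : ℕ) : ℤ) ≤ 1000 * (Neg.Kq κ : ℤ) := by
    have h3 : k + 1 ≤ 1000 * Neg.Kq κ := by have := Neg.one_le_Kq κ; omega
    exact_mod_cast h3
  have hterm := clr_kterm_le hn1 hN.v_le hκ' hU2 hs0 (by linarith only [sL', hU]) (by positivity : (0 : ℤ) ≤ (ℓL κ Φ t p D g f : ℤ))
    (Nat.cast_nonneg _ : (0 : ℤ) ≤ ((k + 1 : ℕ) : ℤ)) hk1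
  have hNn0 : 0 ≤ (shearUnit (nL κ Φ t p D g f) (hL κ Φ t p D g f) : ℤ) * |((k + 1 : ℕ) : ℤ) * sLoY κ Φ t p D g f| +
      |hL κ Φ t p D g f| * |((k + 1 : ℕ) : ℤ) * vL κ Φ t p D g f| + (shearUnit (nL κ Φ t p D g f) (hL κ Φ t p D g f) : ℤ) := by
    have a1 := mul_nonneg hU.le (abs_nonneg (((k + 1 : ℕ) : ℤ) * sLoY κ Φ t p D g f))
    have a2 := mul_nonneg (abs_nonneg (hL κ Φ t p D g f)) (abs_nonneg (((k + 1 : ℕ) : ℤ) * vL κ Φ t p D g f))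
    linarith only [a1, a2, hU]
  have hdiv0 := Int.ediv_nonneg hNn0 hn0.le
  have hNr' : (((NxW κ Φ t p D g f P yL x du z bw) : ℤ) + 1) * (shearUnit (nL κ Φ t p D g f) (hL κ Φ t p D g f) : ℤ) ≤
      600 * (Neg.Kq κ : ℤ) * (shearUnit (nL κ Φ t p D g f) (hL κ Φ t p D g f) : ℤ) := by
    have : (((NxW κ Φ t p D g f P yL x du z bw) : ℤ) + 1) ≤ 600 * (Neg.Kq κ : ℤ) := by exact_mod_cast hNr
    exact mul_le_mul_of_nonneg_right this hU.le
  -- the large fact last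
  have hT := clr_crossOffX_l1 κ Φ t p D g f hN hκ yL hσ hσT (NxW κ Φ t p D g f P yL x du z bw)
  refine le_trans ?_ hr
  unfold πBudX
  have hsLo : (yPrmW (nL κ Φ t p D g f) (ℓL κ Φ t p D g f) (hL κ Φ t p D g f) (vL κ Φ t p D g f) (KS0.R'0N κ Φ (KS.NQ Φ) t p D mk)
      (qB3XA κ Φ t p D g f (KS0.R'0N κ Φ (KS.NQ Φ) t p D mk)) N₃).sLo = sLoY κ Φ t p D g f := rfl
  rw [hsLo]
  rw [← Nat.cast_le (α := ℤ)] at hT hyl ⊢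
  push_cast at hdiv0 hterm
  push_cast [Int.natCast_natAbs] at hT hyl ⊢
  rw [abs_of_nonneg hdiv0]
  linarith only [hT, hyl, hNr', hterm]

end KS

end NegB

end PlanarSkeletonFrmQuasi

end Summit.CriticalPhenomena.PercolationContinuityZ3.Theorems.Transplant

end
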